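import Summits.CriticalPhenomena.PercolationContinuityZ3.Theorems.PercNearOneGluingNoHeavyLowerTailTwoCopyMonotoneBridge
import Literature.Probability.Percolation.PercolationEvents

/-!
# Graph part of the handshake kernel: the `ab`-component of a maximal K2-side (single-source packing, `Q44`)

Support file for crux `stmt-CriticalPhenomena-4575`, seat `prim-bnk-1` gen 27; memo
`run/shared/lean/prim/prim-l12/FROM-prim-bnk-1-gen27-SINGLE-SOURCE-ANATOMY.md` §5d.

For a graph fibre (base edges `C`, marked points `a b c y`) and a K2-side `X₀` (`C ∪ X₀ ≅ ab|cy`), let `A₀ ⊆ X₀` be the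
edges of `X₀` whose endpoints are joined to `a` in `C ∪ X₀`.  This file proves the three walk facts used by the
handshake proof of the K2/K4s residual (memo §5d):

* `reachable_transfer` — generic: reachability inside an adjacency-closed vertex set transfers to any graph containing
  the edges between its vertices;
* `reachable_ab_of_component` — `a ~ b` already in `C ∪ A₀`;
* `not_reachable_cy_of_kernel` — if `K ⊆ X₀`, every edge of `K` outside `A₀` lies in `D`, `a ≁ c` in `C ∪ X₀` and
  `c ≁ y` in `C ∪ D`, then `c ≁ y` in `C ∪ K`;
* `reachable_cy_avoid_component` — if `A₀ ⊆ X`, `c ~ y` and `a ≁ c` in `C ∪ X`, then `c ~ y` in `C ∪ (X \ A₀)`.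

Pure graph theory (`SimpleGraph.Walk` induction); no named facts, no sorries, no new definitions.
-/

namespace Summit.CriticalPhenomena.PercolationContinuityZ3.Theorems

namespace TwoCopyMono

open Finset Literature.Probability.Percolation

/-- **Reachability transfer.**  Let `Q` be a set of vertices closed under `G₁`-adjacency, and suppose every `G₁`-edge
between vertices of `Q` is a `G₂`-edge.  Then `G₁`-reachability from a vertex of `Q` implies `G₂`-reachability. [folklore] -/
theorem reachable_transfer {V : Type*} (G₁ G₂ : SimpleGraph V) (Q : Set V)
    (hQ : ∀ u v, u ∈ Q → G₁.Adj u v → v ∈ Q) (hE : ∀ u v, u ∈ Q → v ∈ Q → G₁.Adj u v → G₂.Adj u v)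
    {s t : V} (hs : s ∈ Q) (h : G₁.Reachable s t) : G₂.Reachable s t := by
  obtain ⟨p⟩ := h
  induction p with
  | nil => exact SimpleGraph.Reachable.refl _
  | @cons u v w hadj p ih =>
    have hv : v ∈ Q := hQ u v hs hadj
    exact (SimpleGraph.Adj.reachable (hE u v hs hv hadj)).trans (ih hv)

variable {n : ℕ}

/-- Adjacency in the open graph of a finite edge set. [folklore] -/
theorem openGraph_coe_adj (S : Finset (Sym2 (Fin n))) (u v : Fin n) :
    (openGraph (↑S : Set (Sym2 (Fin n)))).Adj u v ↔ s(u, v) ∈ S ∧ u ≠ v := by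
  rw [openGraph_adj, Finset.mem_coe]

/-- Monotonicity of reachability in the edge set. [folklore] -/
theorem reachable_mono_finset {S T : Finset (Sym2 (Fin n))} (h : S ⊆ T) {u v : Fin n}
    (hr : (openGraph (↑S : Set (Sym2 (Fin n)))).Reachable u v) : (openGraph (↑T : Set (Sym2 (Fin n)))).Reachable u v :=
  hr.mono (openGraph_mono (Finset.coe_subset.2 h))

/-- **`a ~ b` inside the `ab`-component.**  If `a ~ b` in `C ∪ X₀`, then `a ~ b` in `C ∪ A₀`, where `A₀` consists of the
edges of `X₀` all of whose endpoints are reachable from `a` in `C ∪ X₀`. [this work] -/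
theorem reachable_ab_of_component (C X₀ A₀ : Finset (Sym2 (Fin n))) (a b : Fin n)
    (hA₀ : ∀ e ∈ X₀, (∀ v ∈ e, (openGraph (↑(C ∪ X₀) : Set (Sym2 (Fin n)))).Reachable a v) → e ∈ A₀)
    (hab : (openGraph (↑(C ∪ X₀) : Set (Sym2 (Fin n)))).Reachable a b) :
    (openGraph (↑(C ∪ A₀) : Set (Sym2 (Fin n)))).Reachable a b := by
  set G₁ := openGraph (↑(C ∪ X₀) : Set (Sym2 (Fin n))) with hG₁
  refine reachable_transfer G₁ (openGraph (↑(C ∪ A₀) : Set (Sym2 (Fin n)))) {v | G₁.Reachable a v} ?_ ?_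
    (SimpleGraph.Reachable.refl _) hab
  · intro u v hu huv
    exact SimpleGraph.Reachable.trans hu huv.reachable
  · intro u v hu hv huv
    rw [hG₁, openGraph_coe_adj] at huv
    rw [openGraph_coe_adj]
    refine ⟨?_, huv.2⟩
    rcases Finset.mem_union.1 huv.1 with hC | hX
    · exact Finset.mem_union_left _ hC
    · refine Finset.mem_union_right _ (hA₀ _ hX ?_)
      intro w hw
      rcases Sym2.mem_iff.1 hw with rfl | rfl
      · exact hu
      · exact hv

/-- **No `c–y` connection inside a kernel.**  Let `K ⊆ X₀` and suppose every edge of `K` whose endpoints are not both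
reachable from `a` in `C ∪ X₀` lies in `D`.  If `a ≁ c` in `C ∪ X₀` and `c ≁ y` in `C ∪ D`, then `c ≁ y` in `C ∪ K`.
[this work] -/
theorem not_reachable_cy_of_kernel (C X₀ K D : Finset (Sym2 (Fin n))) (a c y : Fin n) (hK : K ⊆ X₀)
    (hD : ∀ e ∈ K, (¬ ∀ v ∈ e, (openGraph (↑(C ∪ X₀) : Set (Sym2 (Fin n)))).Reachable a v) → e ∈ D)
    (hac : ¬ (openGraph (↑(C ∪ X₀) : Set (Sym2 (Fin n)))).Reachable a c)
    (hcy : ¬ (openGraph (↑(C ∪ D) : Set (Sym2 (Fin n)))).Reachable c y) :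
    ¬ (openGraph (↑(C ∪ K) : Set (Sym2 (Fin n)))).Reachable c y := by
  intro h
  apply hcy
  set G₀ := openGraph (↑(C ∪ X₀) : Set (Sym2 (Fin n))) with hG₀
  set G₁ := openGraph (↑(C ∪ K) : Set (Sym2 (Fin n))) with hG₁
  -- `Q` = vertices NOT reachable from `a` in `C ∪ X₀`; closed under `G₁`-adjacency since `G₁ ≤ G₀`
  refine reachable_transfer G₁ (openGraph (↑(C ∪ D) : Set (Sym2 (Fin n)))) {v | ¬ G₀.Reachable a v} ?_ ?_ ?_ h
  · intro u v hu huv hv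
    apply hu
    have huv₀ : G₀.Adj u v := by
      rw [hG₁, openGraph_coe_adj] at huv
      rw [hG₀, openGraph_coe_adj]
      refine ⟨?_, huv.2⟩
      rcases Finset.mem_union.1 huv.1 with hC | hKe
      · exact Finset.mem_union_left _ hC
      · exact Finset.mem_union_right _ (hK hKe)
    exact hv.trans huv₀.symm.reachable
  · intro u v hu hv huv
    rw [hG₁, openGraph_coe_adj] at huv
    rw [openGraph_coe_adj]
    refine ⟨?_, huv.2⟩
    rcases Finset.mem_union.1 huv.1 with hC | hKe
    · exact Finset.mem_union_left _ hC
    · refine Finset.mem_union_right _ (hD _ hKe ?_)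
      intro hall
      exact hu (hall u (Sym2.mem_mk_left u v))
  · show ¬ G₀.Reachable a c
    exact hac

/-- **The `c–y` path avoids the `ab`-component.**  If `A₀ ⊆ X`, every endpoint of an edge of `A₀` is reachable from `a`
in `C ∪ A₀`, `c ~ y` in `C ∪ X` and `a ≁ c` in `C ∪ X`, then `c ~ y` in `C ∪ (X \ A₀)`. [this work] -/
theorem reachable_cy_avoid_component (C X A₀ : Finset (Sym2 (Fin n))) (a c y : Fin n) (hAX : A₀ ⊆ X)
    (hA : ∀ e ∈ A₀, ∀ v ∈ e, (openGraph (↑(C ∪ A₀) : Set (Sym2 (Fin n)))).Reachable a v)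
    (hcy : (openGraph (↑(C ∪ X) : Set (Sym2 (Fin n)))).Reachable c y)
    (hac : ¬ (openGraph (↑(C ∪ X) : Set (Sym2 (Fin n)))).Reachable a c) :
    (openGraph (↑(C ∪ (X \ A₀)) : Set (Sym2 (Fin n)))).Reachable c y := by
  set G₁ := openGraph (↑(C ∪ X) : Set (Sym2 (Fin n))) with hG₁
  refine reachable_transfer G₁ (openGraph (↑(C ∪ (X \ A₀)) : Set (Sym2 (Fin n)))) {v | ¬ G₁.Reachable a v} ?_ ?_ hac hcy
  · intro u v hu huv hv
    exact hu (hv.trans huv.symm.reachable)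
  · intro u v hu _ huv
    rw [hG₁, openGraph_coe_adj] at huv
    rw [openGraph_coe_adj]
    refine ⟨?_, huv.2⟩
    rcases Finset.mem_union.1 huv.1 with hC | hXe
    · exact Finset.mem_union_left _ hC
    · refine Finset.mem_union_right _ (Finset.mem_sdiff.2 ⟨hXe, ?_⟩)
      intro hA₀
      apply hu
      have hCA : C ∪ A₀ ⊆ C ∪ X := Finset.union_subset_union (subset_refl C) hAX
      exact reachable_mono_finset hCA (hA _ hA₀ u (Sym2.mem_mk_left u v))

end TwoCopyMono

end Summit.CriticalPhenomena.PercolationContinuityZ3.Theorems
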